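import Literature.Computability.AlgebraicComplexity.BorderApolarityCandidates
import HarnessLib

/-!
# Border apolarity in tri-degree `(111)`, span side: the candidate TRIPLE of a decomposition

Topic `Literature/Computability/AlgebraicComplexity`. Sequel of `BorderApolarityCandidates.lean`
(the `(110)`-candidate `E ⊆ A ⊗ B` of an approximate decomposition and its `(210)`/`(120)` tests),
adding what Conner–Harper–Landsberg 2023 call the `(111)`-test (§3 (ii), §6: "Among the candidate
triples, none pass the `(111)`-test"), in the same elementary span-side form over `K[ε]`: for an
order-`h` approximate decomposition `∑_{ρ<r} u_ρ(ε) ⊗ v_ρ(ε) ⊗ w_ρ(ε) = ε^h t + O(ε^{h+1})` of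
`t ∈ K^ι ⊗ K^κ ⊗ K^μ`, the THREE pair candidates `E₁ = lim L·{u_ρ ⊗ v_ρ} ⊆ A ⊗ B`,
`E₂ = lim L·{v_ρ ⊗ w_ρ} ⊆ B ⊗ C`, `E₃ = lim L·{u_ρ ⊗ w_ρ} ⊆ A ⊗ C` of ONE decomposition satisfy,
besides their own `(110)`-type conditions, `dim (E₁ ⊗ C) ∩ (A ⊗ E₂) ∩ (E₃ ⊗ B)' ≥ r` — the limit
of `L·{u_ρ ⊗ v_ρ ⊗ w_ρ}` lies in the intersection and has dimension `r` once the points are in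
general position.

* `BorderApolarity.tripleInter E₁ E₂ E₃` — the `(111)`-test space `(E₁ ⊗ C) ∩ (A ⊗ E₂) ∩ (E₃ ⊗ B)`
  in coordinates (all `c`-, `a`-, `b`-slices in `E₁`, `E₂`, `E₃`).
* `BorderApolarity.IsCandidateTriple r t E₁ E₂ E₃` — the conjunction of the necessary conditions:
  `dim Eᵢ ≤ r`, the slices of `t` lie in the `Eᵢ`, the six `(210)`-type tests and the `(111)`-test
  have dimension `≥ r`.
* `BorderApolarity.exists_candidateTriple_of_isApproxDecomposition` — **every order-`h`
  approximate decomposition with `r` triads yields a candidate triple** (after perturbing all three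
  slots to general position at coordinate triples with pairwise-injective projections; CHL 2023,
  §2.3 (i)–(iii) in tri-degrees `(110),(011),(101),(210),(120),(021),(012),(201),(102),(111)`).

## References

* A. Conner, A. Harper, J. M. Landsberg, *New lower bounds for matrix multiplication and `det₃`*,
  Forum Math. Pi 11 (2023) e17, arXiv:1911.07981 — §2.3, §3 (ii) (the `(111)` test), §6.
  [ConnerHarperLandsberg2023]
* W. Buczyńska, J. Buczyński, *Apolarity, border rank, and multigraded Hilbert scheme*, Duke Math.
  J. 170 (2021) — Thm. 1.2 (border apolarity). [BuczynskaBuczynski2021]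
-/

noncomputable section

open Polynomial
open scoped Polynomial BigOperators

namespace Literature.Computability.AlgebraicComplexity

namespace BorderApolarity

open TensorApolarity

universe u v

variable {K : Type u} [Field K]
variable {ι κ μ : Type}

/-! ## Slices of a 3-array and the `(111)`-test space -/

/-- The `μ`-slice at `c` of a function on `ι × κ × μ`. [folklore] -/
def sliceC (c : μ) : (ι × κ × μ → K) →ₗ[K] (ι × κ → K) where
  toFun x ab := x (ab.1, ab.2, c)
  map_add' _ _ := rfl
  map_smul' _ _ := rfl

/-- The `ι`-slice at `a` of a function on `ι × κ × μ`. [folklore] -/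
def sliceA (a : ι) : (ι × κ × μ → K) →ₗ[K] (κ × μ → K) where
  toFun x bc := x (a, bc.1, bc.2)
  map_add' _ _ := rfl
  map_smul' _ _ := rfl

/-- The `κ`-slice at `b` of a function on `ι × κ × μ`. [folklore] -/
def sliceB (b : κ) : (ι × κ × μ → K) →ₗ[K] (ι × μ → K) where
  toFun x ac := x (ac.1, b, ac.2)
  map_add' _ _ := rfl
  map_smul' _ _ := rfl

/-- Entries of `sliceC`. [folklore] -/
@[simp] theorem sliceC_apply (c : μ) (x : ι × κ × μ → K) (ab : ι × κ) :
    sliceC c x ab = x (ab.1, ab.2, c) := rfl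

/-- Entries of `sliceA`. [folklore] -/
@[simp] theorem sliceA_apply (a : ι) (x : ι × κ × μ → K) (bc : κ × μ) :
    sliceA a x bc = x (a, bc.1, bc.2) := rfl

/-- Entries of `sliceB`. [folklore] -/
@[simp] theorem sliceB_apply (b : κ) (x : ι × κ × μ → K) (ac : ι × μ) :
    sliceB b x ac = x (ac.1, b, ac.2) := rfl

/-- **The `(111)`-test space** `(E₁ ⊗ C) ∩ (A ⊗ E₂) ∩ (E₃ ⊗ B)` of three pair candidates
`E₁ ⊆ A ⊗ B`, `E₂ ⊆ B ⊗ C`, `E₃ ⊆ A ⊗ C`: the 3-arrays all of whose slices lie in the respective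
candidate. [cite: ConnerHarperLandsberg2023, §3 (ii)] -/
def tripleInter (E₁ : Submodule K (ι × κ → K)) (E₂ : Submodule K (κ × μ → K))
    (E₃ : Submodule K (ι × μ → K)) : Submodule K (ι × κ × μ → K) :=
  ((⨅ c, E₁.comap (sliceC c)) ⊓ ⨅ a, E₂.comap (sliceA a)) ⊓ ⨅ b, E₃.comap (sliceB b)

/-- Membership in the `(111)`-test space. [folklore] -/
theorem mem_tripleInter {E₁ : Submodule K (ι × κ → K)} {E₂ : Submodule K (κ × μ → K)}
    {E₃ : Submodule K (ι × μ → K)} {x : ι × κ × μ → K} :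
    x ∈ tripleInter E₁ E₂ E₃ ↔
      (∀ c, sliceC c x ∈ E₁) ∧ (∀ a, sliceA a x ∈ E₂) ∧ ∀ b, sliceB b x ∈ E₃ := by
  simp [tripleInter, Submodule.mem_iInf, Submodule.mem_inf, and_assoc]

/-- The `(111)`-test space is monotone in the three candidates. [folklore] -/
theorem tripleInter_mono {E₁ E₁' : Submodule K (ι × κ → K)} {E₂ E₂' : Submodule K (κ × μ → K)}
    {E₃ E₃' : Submodule K (ι × μ → K)} (h₁ : E₁ ≤ E₁') (h₂ : E₂ ≤ E₂') (h₃ : E₃ ≤ E₃') :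
    tripleInter E₁ E₂ E₃ ≤ tripleInter E₁' E₂' E₃' := by
  intro x hx
  rw [mem_tripleInter] at hx ⊢
  exact ⟨fun c => h₁ (hx.1 c), fun a => h₂ (hx.2.1 a), fun b => h₃ (hx.2.2 b)⟩

/-! ## Candidate triples -/

/-- **A candidate triple** for `bR(t) ≤ r` (the span-side necessary conditions of border apolarity in
tri-degrees of total degree `≤ 3` with at most two slots doubled): `dim Eᵢ ≤ r`, the three families
of slices of `t` lie in `E₁ ⊆ A ⊗ B`, `E₂ ⊆ B ⊗ C`, `E₃ ⊆ A ⊗ C`, the six `(210)`-type test spaces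
and the `(111)`-test space have dimension `≥ r`. [cite: ConnerHarperLandsberg2023, §2.3 and §3] -/
structure IsCandidateTriple [Fintype ι] [Fintype κ] [Fintype μ] (r : ℕ) (t : ι → κ → μ → K)
    (E₁ : Submodule K (ι × κ → K)) (E₂ : Submodule K (κ × μ → K))
    (E₃ : Submodule K (ι × μ → K)) : Prop where
  /-- `dim E₁ ≤ r` -/
  finrank₁ : Module.finrank K E₁ ≤ r
  /-- `dim E₂ ≤ r` -/
  finrank₂ : Module.finrank K E₂ ≤ r
  /-- `dim E₃ ≤ r` -/
  finrank₃ : Module.finrank K E₃ ≤ r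
  /-- `t(·,·,c) ∈ E₁` -/
  slice₁ : ∀ c, (fun ab : ι × κ => t ab.1 ab.2 c) ∈ E₁
  /-- `t(a,·,·) ∈ E₂` -/
  slice₂ : ∀ a, (fun bc : κ × μ => t a bc.1 bc.2) ∈ E₂
  /-- `t(·,b,·) ∈ E₃` -/
  slice₃ : ∀ b, (fun ac : ι × μ => t ac.1 b ac.2) ∈ E₃
  /-- the `(210)` test -/
  testI₁ : r ≤ Module.finrank K (testI E₁)
  /-- the `(120)` test -/
  testK₁ : r ≤ Module.finrank K (testK E₁)
  /-- the `(021)` test -/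
  testI₂ : r ≤ Module.finrank K (testI E₂)
  /-- the `(012)` test -/
  testK₂ : r ≤ Module.finrank K (testK E₂)
  /-- the `(201)` test -/
  testI₃ : r ≤ Module.finrank K (testI E₃)
  /-- the `(102)` test -/
  testK₃ : r ≤ Module.finrank K (testK E₃)
  /-- the `(111)` test -/
  triple : r ≤ Module.finrank K (tripleInter E₁ E₂ E₃)

/-! ## The points `u_ρ ⊗ v_ρ ⊗ w_ρ` and their `L`-span -/

section Points

variable {r : ℕ} (u : Fin r → ι → K[X]) (v : Fin r → κ → K[X]) (w : Fin r → μ → K[X])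

/-- The moving points `u_ρ ⊗ v_ρ ⊗ w_ρ`. [cite: ConnerHarperLandsberg2023, §2.3] -/
def pt₄ : Fin r → ι × κ × μ → K[X] := fun ρ p => u ρ p.1 * v ρ p.2.1 * w ρ p.2.2

variable (L : Type v) [Field L] [Algebra K[X] L]

/-- `W₄ = L · {u_ρ ⊗ v_ρ ⊗ w_ρ}` (the curve `E₁₁₁(ε)` over `L = K(ε)`).
[cite: ConnerHarperLandsberg2023, §2.3] -/
def W₄ : Submodule L (ι × κ × μ → L) := Submodule.span L (Set.range fun ρ => polyVec L (pt₄ u v w ρ))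

/-- `μ`-slices of `W₄` lie in `W₁(u, v)`. [folklore] -/
theorem map_sliceC_W₄_le (c : μ) : (W₄ u v w L).map (sliceC (K := L) c) ≤ W₁ u v L := by
  rw [W₄, Submodule.map_span, Submodule.span_le]
  rintro _ ⟨_, ⟨ρ, rfl⟩, rfl⟩
  have : sliceC (K := L) c (polyVec L (pt₄ u v w ρ)) =
      algebraMap K[X] L (w ρ c) • polyVec L (pt₁ u v ρ) := by
    funext ab
    simp only [sliceC_apply, polyVec_apply, pt₄, pt₁, Pi.smul_apply, smul_eq_mul, map_mul]
    ring
  rw [this]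
  exact Submodule.smul_mem _ _ (Submodule.subset_span ⟨ρ, rfl⟩)

/-- `ι`-slices of `W₄` lie in `W₁(v, w)`. [folklore] -/
theorem map_sliceA_W₄_le (a : ι) : (W₄ u v w L).map (sliceA (K := L) a) ≤ W₁ v w L := by
  rw [W₄, Submodule.map_span, Submodule.span_le]
  rintro _ ⟨_, ⟨ρ, rfl⟩, rfl⟩
  have : sliceA (K := L) a (polyVec L (pt₄ u v w ρ)) =
      algebraMap K[X] L (u ρ a) • polyVec L (pt₁ v w ρ) := by
    funext bc
    simp only [sliceA_apply, polyVec_apply, pt₄, pt₁, Pi.smul_apply, smul_eq_mul, map_mul]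
    ring
  rw [this]
  exact Submodule.smul_mem _ _ (Submodule.subset_span ⟨ρ, rfl⟩)

/-- `κ`-slices of `W₄` lie in `W₁(u, w)`. [folklore] -/
theorem map_sliceB_W₄_le (b : κ) : (W₄ u v w L).map (sliceB (K := L) b) ≤ W₁ u w L := by
  rw [W₄, Submodule.map_span, Submodule.span_le]
  rintro _ ⟨_, ⟨ρ, rfl⟩, rfl⟩
  have : sliceB (K := L) b (polyVec L (pt₄ u v w ρ)) =
      algebraMap K[X] L (v ρ b) • polyVec L (pt₁ u w ρ) := by
    funext ac
    simp only [sliceB_apply, polyVec_apply, pt₄, pt₁, Pi.smul_apply, smul_eq_mul, map_mul]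
    ring
  rw [this]
  exact Submodule.smul_mem _ _ (Submodule.subset_span ⟨ρ, rfl⟩)

/-- **`lim W₄ ≤ (lim W₁(u,v) ⊗ C) ∩ (A ⊗ lim W₁(v,w)) ∩ (lim W₁(u,w) ⊗ B)'`**: the slice relations
survive the limit (span-side CHL 2023, §2.3 (iii) in tri-degree `(111)`).
[cite: ConnerHarperLandsberg2023, §2.3 (iii)] -/
theorem limSub_W₄_le : limSub K L (W₄ u v w L) ≤
    tripleInter (limSub K L (W₁ u v L)) (limSub K L (W₁ v w L)) (limSub K L (W₁ u w L)) := by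
  intro x hx
  obtain ⟨g, hg, rfl⟩ := (mem_limSub_iff (K := K) L).1 hx
  have hgW : polyVec L g ∈ W₄ u v w L := hg
  refine mem_tripleInter.2 ⟨fun c => ?_, fun a => ?_, fun b => ?_⟩
  · have hmem : (fun ab : ι × κ => g (ab.1, ab.2, c)) ∈ latt K L (W₁ u v L) := by
      rw [mem_latt]
      have : polyVec L (fun ab : ι × κ => g (ab.1, ab.2, c)) = sliceC (K := L) c (polyVec L g) :=
        funext fun ab => rfl
      rw [this]
      exact map_sliceC_W₄_le u v w L c (Submodule.mem_map_of_mem hgW)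
    exact ev0_mem_limSub (K := K) L hmem
  · have hmem : (fun bc : κ × μ => g (a, bc.1, bc.2)) ∈ latt K L (W₁ v w L) := by
      rw [mem_latt]
      have : polyVec L (fun bc : κ × μ => g (a, bc.1, bc.2)) = sliceA (K := L) a (polyVec L g) :=
        funext fun bc => rfl
      rw [this]
      exact map_sliceA_W₄_le u v w L a (Submodule.mem_map_of_mem hgW)
    exact ev0_mem_limSub (K := K) L hmem
  · have hmem : (fun ac : ι × μ => g (ac.1, b, ac.2)) ∈ latt K L (W₁ u w L) := by
      rw [mem_latt]
      have : polyVec L (fun ac : ι × μ => g (ac.1, b, ac.2)) = sliceB (K := L) b (polyVec L g) :=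
        funext fun ac => rfl
      rw [this]
      exact map_sliceB_W₄_le u v w L b (Submodule.mem_map_of_mem hgW)
    exact ev0_mem_limSub (K := K) L hmem

variable [IsFractionRing K[X] L] [Fintype ι] [Fintype κ] [Fintype μ]

/-- `dim lim W₄ = r` when the points `u_ρ ⊗ v_ρ ⊗ w_ρ` are `L`-independent.
[cite: ConnerHarperLandsberg2023, §2.3] -/
theorem finrank_limSub_W₄_eq (hli : LinearIndependent L fun ρ => polyVec L (pt₄ u v w ρ)) :
    Module.finrank K (limSub K L (W₄ u v w L)) = r := by
  rw [finrank_limSub_eq K L, W₄, finrank_span_eq_card hli, Fintype.card_fin]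

end Points

end BorderApolarity

end Literature.Computability.AlgebraicComplexity

end
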